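import Literature.AnabelianGeometry.EtaleTheta.TemperedFrobenioidLaws
import Literature.AnabelianGeometry.EtaleTheta.TemperedFrobenioidOfGaloisCoveringRankOnePoint
import Literature.AnabelianGeometry.EtaleTheta.Discharge.Sec3Cor38OfRankOnePoint
import Literature.AnabelianGeometry.EtaleTheta.Discharge.Sec3Cor38CriterionCoordWeak

/-!
# [EtTh] §3 census laws A6/A7 AT THE RANK-ONE-POINT MODELS OF RECORD: `PfAtQ` and `BsFldZQ` HOLD

S. Mochizuki, *The étale theta function …*, Publ. RIMS **45** (2009) [MochizukiEtTh2009], §3 Def. 3.3 (iii) p.73 (Prop. 3.2 (i):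
`Φ₀(Y)^pf ≅` a product of copies of `ℚ_{≥0}`), Def. 3.6 (ii)(a) p.77 (`Φ^{bs-fld}` monoprime), Cor. 3.8 p.81 (criterion for
`Λ ∈ {ℤ, ℚ}`) [cite: MochizukiEtTh2009, Def 3.6 (ii) p.77].  abc-iut cell, layer L2; seat abc-iut-L2-t3 (gen 5), owner of the census
predicates `TemperedFrobenioid.PfAtQ` (A7 = binder `hQ`, GAP G-w4d084-3) and `TemperedFrobenioid.BsFldZQ` (A6 = `hΛ`)
(p443354).  PROOF-ONLY (0 defs); inputs BY NAME: abc-iut-w6-d048's `TemperedFrobenioid.ofRankOnePoint` / `RankOnePoint.*`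
(p444230 lineage: the tempered Frobenioid of a rank-one point of the connected Def. 3.3 (iii) data — e.g. `TateTowerFrd`,
`OneCompFrd` weak), `hQ_ofRankOnePoint` (`Sec3Cor38OfRankOnePoint`: (hZQ), (hsat) checked there) and the w5-d124 lineage's
`isZQMonoprime_bsFld_weak`; nothing landed is edited or restated.
* **`TemperedFrobenioid.pfAtQ_ofRankOnePoint`** — A7 HOLDS: every localized perfection `Φ(W)^pf_𝔮` is `ℚ`-monoprime
  (= `hQ_ofRankOnePoint`, repackaged as the census predicate `PfAtQ`);
* `RankOnePoint.isBaseFieldTheoreticDiv_ofRankOnePoint` — every divisor is base-field-theoretic at a rank-one point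
  (`pfImage_inf_cnstR_eq`); **`TemperedFrobenioid.bsFldZQ_ofRankOnePoint`** — A6 HOLDS (`Φ^{bs-fld}` of type `ℤ` or `ℚ`:
  not `ℝ`, by `isZQMonoprime_bsFld_weak` with the generator `Z₀ = ι(e⁻¹ 1) ≠ 1`).
So at the NV models of record the census binders A6/A7 are THEOREMS (A9 ✓ / A10 ✗ there: `Sec3LawsAtTemperedModels`, p453688 —
for the tempered-base twins).  HONEST FRAMING: NV/register bookkeeping; typed ≠ proved; nothing here bears on [IUTchIII] Cor. 3.12.
-/

noncomputable section

namespace Literature.AnabelianGeometry.EtaleTheta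

open CategoryTheory Opposite Function Literature.AlgebraicGeometry.Frobenioids LogDivisorModel LogDivisorModel.GaloisAction

namespace TemperedFrobenioid

variable {Z : LogDivisorModel.{0}} {G : Type} [Group G] {A : Z.GaloisAction G} (hZ : Z.CuspLaws) (P : RankOnePoint A)
  (hpf : ∀ Y : ((isConnectedGSet (G := G)).FullSubcategory)ᵒᵖ,
    IsPerfFactorialCof ((DivisorMonoids.ofGaloisActionConnected A hZ).Φ₀.obj Y))
  (R S : ((Discrete PUnit.{1})ᵒᵖ ⥤ CommMonCat.{0}) → Prop)

namespace RankOnePoint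

/-- At a rank-one point EVERY divisor is base-field-theoretic (`Φ ⊆ ℝ·Φ₀^cnst`, abc-iut-w6-d048's `pfImage_inf_cnstR_eq`).
[cite: MochizukiEtTh2009, Def 3.6 (iv) p.78] -/
theorem isBaseFieldTheoreticDiv_ofRankOnePoint (W : Discrete PUnit.{1})
    (x : (ofRankOnePoint hZ P hpf R S).Φ.carrier (op W)) : (ofRankOnePoint hZ P hpf R S).IsBaseFieldTheoreticDiv x :=
  Submonoid.mem_inf.2 ⟨x.2, P.of_mem_cnstR_of_mem_pfImage hZ hpf x.2⟩

end RankOnePoint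

/-- **A7 `PfAtQ` HOLDS at the rank-one-point tempered Frobenioids of record**: every localized perfection `Φ(W)^pf_𝔮` is
`ℚ`-monoprime (`hQ_ofRankOnePoint`, from (hZQ) `Φ₀(S₀) ≅ ℕ` `ℤ`-monoprime and the rational support of `Φ`).
[cite: MochizukiEtTh2009, Def 3.3 (iii) p.73] -/
theorem pfAtQ_ofRankOnePoint : (ofRankOnePoint hZ P hpf R S).PfAtQ := fun W 𝔮 =>
  hQ_ofRankOnePoint hZ P hpf R S W 𝔮

/-- **A6 `BsFldZQ` HOLDS at the rank-one-point tempered Frobenioids of record**: `Φ^{bs-fld}(W)` is `ℤ`- or `ℚ`-monoprime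
(not `ℝ`: `isZQMonoprime_bsFld_weak` with the base-field-theoretic generator `Z₀ = ι(e⁻¹ 1) ≠ 1`).
[cite: MochizukiEtTh2009, Def 3.6 (ii) p.77] -/
theorem bsFldZQ_ofRankOnePoint : (ofRankOnePoint hZ P hpf R S).BsFldZQ := fun W => by
  let Z₀ : (ofRankOnePoint hZ P hpf R S).Φ.carrier (op W) :=
    ⟨(hpf (op P.S₀)).weak.toRealification (Perfection.of _ (P.e.symm (Multiplicative.ofAdd 1))), ⟨_, rfl⟩⟩
  have hZ₀1 : Z₀ ≠ 1 := fun h => P.toRealification_gen_ne_one hZ hpf (congrArg Subtype.val h)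
  exact isZQMonoprime_bsFld_weak (pfAtQ_ofRankOnePoint hZ P hpf R S W)
    (RankOnePoint.isBaseFieldTheoreticDiv_ofRankOnePoint hZ P hpf R S W Z₀) hZ₀1

/-- A6 ∧ A7 at the rank-one point, packaged. [cite: MochizukiEtTh2009, Def 3.6 (ii) p.77] -/
theorem bsFldZQ_and_pfAtQ_ofRankOnePoint :
    (ofRankOnePoint hZ P hpf R S).BsFldZQ ∧ (ofRankOnePoint hZ P hpf R S).PfAtQ :=
  ⟨bsFldZQ_ofRankOnePoint hZ P hpf R S, pfAtQ_ofRankOnePoint hZ P hpf R S⟩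

end TemperedFrobenioid

end Literature.AnabelianGeometry.EtaleTheta

end
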